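import Mathlib
import HarnessLib
import Summits.HubbardSuperconductivity.HubbardSuperconductivity.Theorems.KLProgrammeKLRegimeEnginePlainLineFromMomentumRepresentation
import Summits.HubbardSuperconductivity.HubbardSuperconductivity.Theorems.KLProgrammeKLRegimeEngineIsoTuplePatterns
import Summits.HubbardSuperconductivity.HubbardSuperconductivity.Theorems.KLProgrammeKLRegimeEngineLevelsQuarticFromPlainLine

/-!
# Route `KLProgramme` — crux K3 ENGINE (stmt-HubbardSuperconductivity-20437 `KLRegimeEngineV17F2`), ROW (X) `stub_engine_exports`, conjunct (X).1
# (binder `hX1`, E1-LEDGER §1 #3): the QUARTIC ROW of `LevelsUAt … K j` — `klAnisoLegKernelNormAt L M β U μ K klE0 j 4 Ωe ≤ c₂·(Klam·|U|)·2^j` —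
# FROM ONE MOMENTUM-SPACE PAIR-TRANSFER REPRESENTATION of the `↑↓` quartic kernel of `𝒱_j[K]`: the chain (T7) → (patterns) → (T3) in ONE call
# (cell gate-hubbard-kl, seat p3 g25)

E1-LEDGER §1 #3 prices the quartic row of (X).1 as «value side ✓ → (T2) modulo (s1) freezing `hW`, (s2) sup-vs-pin `hB` + bump data, (s3) kernel↔value feed
`hV` → (T3)».  (T7) `TorusFourierL2.plainFourLegLine_of_momentumRepresentation` (k3c2-p3 g16) already composes (T5b)+(T1)+(T2) into ONE call from a
MOMENTUM-SPACE representation at ONE label string (charges `(+,+,−,−)`, spins `σ`, pin at leg `0`); `…EngineIsoTuplePatterns` (k3c2-p2 g12) reduces EVERY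
spin/charge string of the UNWEIGHTED pinned line `fixedTupleL1` of `𝒱ₙ[K]` to the standard pattern (factor `2`); (T3) `levelsU_quarticRow_of_plainLine_klEng`
(k3c2-p3) turns the all-strings plain line `S₄` plus ONE table inequality into the quartic row.  This file chains them, so that the quartic row of (X).1 at
`(K, j)` reads off the SAME producer object as row (b)'s binders #5 (E4) / #6 (`…EngineRowBPlainLineOfMomentumRep`, this seat) — the pair-transfer
representation of the `↑↓` Cooper kernel, here with SECOND-difference (T1) bump data and NO weight:

* §1 **`plainLine_klEffectiveAction_allStrings_of_momentumRepresentation`** — any frame `K`, any `e₀ n`: (T7)'s hypotheses VERBATIM at `σ = (0,1,0,1)` for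
  `𝒱ₙ[K] = klEffectiveAction … K e₀ n` ⟹ `∀ s c' y`, `fixedTupleL1 … (((0, s i), c' i)) y ≤ 2·(ε³·(‖κ‖(2M·L²)²)·√(10485760·n₀)·(2M·L²)·Σ‖a_i‖A_i + r)`
  (Cooper → standard pattern by `fixedTupleL1_sectorisedKernel_comp_perm` — `𝒱ₙ[K]` is frequency- and momentum-conserving — then
  `fixedTupleL1_sectorisedKernel_klEffectiveAction_le_two_mul_of_std`);
* §2 **`levelsUQuarticRow_klEng_of_momentumRepresentation`** — `∃ CA > 0` (the constant of (T3)) such that, under (T3)'s binders (`P.WF`, `R.WF2`,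
  `0 < c ≤ klEngC₃6 ⊓ klThinCountC₃`, `μ ∈ klWindowC`, `0 < U ≤ klEngU₀9 ⊓ klThinCountU₀`, β-window, `FrameOK R U (nScales β) μ K`, `klEngL₃/M₃`,
  `1 ≤ j ≤ n_β+1`), a representation of the `↑↓` quartic momentum kernel of `𝒱_j[K]` with (T1) data and remainder line `r`, closing as
  `2·klThinCountC·CA⁴·(2·(ε³·(‖κ‖(2M·L²)²)·√(10485760·n₀)·(2M·L²)·Σ‖a_i‖A_i + r)) ≤ c₂·(Klam·|U|)`, gives `∀ Ωe`, `klAnisoLegKernelNormAt … K klE0 j 4 Ωe ≤ c₂·(Klam·|U|)·2^j`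
  — the quartic conjunct of `LevelsUAt L M c P β U μ K j` at `c 2 = c₂`, U-currency iff `Σ‖a_i‖A_i = O(U)` (the sign-resolved Cooper running) and `r = O(U)`.
Everything is proved; no definitions; the representation stays a HYPOTHESIS (E1); nothing asserts (X).1, `hX1`, any stub of 20437, K3, U₀, the window or
superconductivity.  References: BGM 2006 §2.1 (1)–(3), §2.3 (2.17), (2.41a), §2.8 (2.76)–(2.81), (2.96)–(2.98), §3 (3.65) [cite: BenfattoGiulianiMastropietro2006].
-/

noncomputable section

namespace Summit.HubbardSuperconductivity.HubbardSuperconductivity.Theorems.EngineV8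

set_option linter.dupNamespace false -- summit = problem name (single-conjunct summit), D-0017

open Classical
open Real Finset Complex Literature.MathematicalPhysics.QuantumLattice Literature.Probability.LatticeModels GrassmannAlgebra
open Literature.MathematicalPhysics.QuantumLattice.FermiRG
open Summit.HubbardSuperconductivity.HubbardSuperconductivity.Theorems.KLProgrammeLegKernels
open Summit.HubbardSuperconductivity.HubbardSuperconductivity.Theorems.KLRegimeSplit
open Summit.HubbardSuperconductivity.HubbardSuperconductivity.Theorems.DispersionFlow
open Summit.HubbardSuperconductivity.HubbardSuperconductivity.Theorems.KLRegimeWick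
open Summit.HubbardSuperconductivity.HubbardSuperconductivity.Theorems.TorusFourierL2

variable {L M : ℕ} [NeZero L] [NeZero M]

/-! ## §1 Every label string of the plain (unweighted) pinned line from ONE momentum representation -/

/-- **THE PLAIN FOUR-LEG PINNED LINE OF `𝒱ₙ[K]` AT EVERY SPIN/CHARGE STRING FROM ONE MOMENTUM-SPACE REPRESENTATION** of its `↑↓` quartic momentum kernel on
the Cooper pattern `(ψ⁺↑, ψ⁺↓, ψ⁻↑, ψ⁻↓)` — the hypotheses of (T7) `plainFourLegLine_of_momentumRepresentation` VERBATIM at `σ = (0,1,0,1)`: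
`∀ s c' y, fixedTupleL1 … (((0, s i), c' i)) y ≤ 2·(ε³·(‖κ‖(2M·L²)²)·√(10485760·n₀)·(2M·L²)·Σ‖a_i‖A_i + r)`.
[cite: BenfattoGiulianiMastropietro2006, §2.1 (1)-(3), §2.3 (2.17), §3 (3.65)] -/
theorem plainLine_klEffectiveAction_allStrings_of_momentumRepresentation {ι : Type*} {β : ℝ} (hβ : 0 < β) (U μ : ℝ) (K : TrigPolyC4v) (e₀ : ℝ)
    (n : ℕ) (S : Finset ι) (a : ι → ℂ) (κ : ℂ) (G : ι → TorusSite 1 (2 * M) × TorusSite 2 L → ℂ) (ρ : (Fin 4 → FreqMomentum L M) → ℂ)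
    (hker : ∀ k : Fin 4 → FreqMomentum L M,
      kernel ℂ (klEffectiveAction L M β U μ K e₀ n) 4 (fun i => ((k i, (![0, 1, 0, 1] : Fin 4 → Fin 2) i), (![0, 0, 1, 1] : Fin 4 → Fin 2) i)) =
        ∑ i ∈ S, a i * (κ * (if ((fun _ : Fin 1 => ((((k 0).1 : ℕ) : ZMod (2 * M)))), (k 0).2) + ((fun _ : Fin 1 => ((((k 1).1 : ℕ) : ZMod (2 * M)))), (k 1).2) = (((fun _ : Fin 1 => ((((k 2).1 : ℕ) : ZMod (2 * M)))), (k 2).2) : TorusSite 1 (2 * M) × TorusSite 2 L) + ((fun _ : Fin 1 => ((((k 3).1 : ℕ) : ZMod (2 * M)))), (k 3).2) then (fun Q => G i (-Q)) (((fun _ : Fin 1 => ((((k 0).1 : ℕ) : ZMod (2 * M)))), (k 0).2) + ((fun _ : Fin 1 => ((((k 1).1 : ℕ) : ZMod (2 * M)))), (k 1).2)) else 0)) + ρ k)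
    (s₀ s₁ A : ι → ℝ) (Ns : ι → ℕ) {n₀ r : ℝ} (hn₀ : 0 ≤ n₀)
    (hs₀ : ∀ i ∈ S, 0 < s₀ i) (hs₀1 : ∀ i ∈ S, s₀ i ≤ 1) (hs₁ : ∀ i ∈ S, 0 < s₁ i) (hs₁1 : ∀ i ∈ S, s₁ i ≤ 1)
    (hA : ∀ i ∈ S, 0 ≤ A i) (hNs : ∀ i ∈ S, (Ns i : ℝ) ≤ n₀ * (s₀ i * (2 * M : ℕ)) * (s₁ i * L) ^ 2)
    (hsupp : ∀ i ∈ S, (univ.filter fun q => G i q ≠ 0).card ≤ Ns i) (hsup : ∀ i ∈ S, ∀ q, ‖G i q‖ ≤ A i)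
    (h₀ : ∀ i ∈ S, ∀ q, ‖(fwdDiff ((fun _ : Fin 1 => (1 : ZMod (2 * M))), (0 : TorusSite 2 L)))^[2] (G i) q‖ ≤
      A i * (4 / (s₀ i * (2 * M : ℕ))) ^ 2)
    (h₁ : ∀ i ∈ S, ∀ q (l : Fin 2), ‖(fwdDiff ((0 : TorusSite 1 (2 * M)), (Pi.single l (1 : ZMod L) : TorusSite 2 L)))^[2] (G i) q‖ ≤
      A i * (4 / (s₁ i * L)) ^ 2)
    (hr : ∀ y : SpaceTimeIdx L M, fixedTupleL1 L M β 3
      (fun (Ω : Fin 4 → SectorLeg 1) (x : Fin 4 → SpaceTimeIdx L M) =>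
        ∑ k : Fin 4 → FreqMomentum L M, (∏ i, trivialMultiplier L M (Ω i).1.1 (k i) * hubbardPlaneWave L M β (Ω i).2 (k i) (x i)) * ρ k)
      (fun i : Fin 4 => ((((0 : Fin 1), (![0, 1, 0, 1] : Fin 4 → Fin 2) i) : Fin 1 × Fin 2), (![0, 0, 1, 1] : Fin 4 → Fin 2) i)) y ≤ r)
    (s c' : Fin 4 → Fin 2) (y : SpaceTimeIdx L M) :
    fixedTupleL1 L M β 3 (sectorisedKernel L M β (trivialMultiplier L M) (klEffectiveAction L M β U μ K e₀ n) 4)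
        (fun i => ((((0 : Fin 1), s i) : Fin 1 × Fin 2), c' i)) y ≤
      2 * (imagTimeWeight β M ^ 3 * ((‖κ‖ * ((((2 * M : ℕ) : ℝ) * (L : ℝ) ^ 2) ^ 2)) * (Real.sqrt (10485760 * n₀) * (((2 * M : ℕ) : ℝ) * (L : ℝ) ^ 2))) *
        ∑ i ∈ S, ‖a i‖ * A i + r) := by
  set V := klEffectiveAction L M β U μ K e₀ n with hV
  -- (T7) at the Cooper pattern
  have hT7 := plainFourLegLine_of_momentumRepresentation hβ V (![0, 1, 0, 1] : Fin 4 → Fin 2) S a κ G ρ hker s₀ s₁ A Ns hn₀ hs₀ hs₀1 hs₁ hs₁1 hA hNs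
    hsupp hsup h₀ h₁ hr
  -- the conservation laws of `𝒱ₙ[K]`
  have hfreq : ∀ (m : ℕ) (X : Fin m → HubbardFieldIdx L M),
      (∑ i, (if (X i).2 = 0 then (1 : ℤ) else -1) * matsubaraInt M (X i).1.1.1) ≠ 0 → kernel ℂ V m X = 0 :=
    fun _ _ hX => kernel_klEffectiveAction_eq_zero_of_freq β U μ K e₀ n hX
  have hmom : ∀ (m : ℕ) (X : Fin m → HubbardFieldIdx L M), (∑ i, signedMomentum L (X i).2 (X i).1.1.2) ≠ 0 → kernel ℂ V m X = 0 :=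
    fun m' X hX => klEffectiveAction_momentumConserving β U μ K e₀ n m' X hX
  -- nonnegativity of the bound
  have hS0 : 0 ≤ imagTimeWeight β M ^ 3 * ((‖κ‖ * ((((2 * M : ℕ) : ℝ) * (L : ℝ) ^ 2) ^ 2)) *
      (Real.sqrt (10485760 * n₀) * (((2 * M : ℕ) : ℝ) * (L : ℝ) ^ 2))) * ∑ i ∈ S, ‖a i‖ * A i + r := by
    refine le_trans ?_ (hT7 y)
    unfold fixedTupleL1
    exact mul_nonneg (pow_nonneg (imagTimeWeight_nonneg hβ.le M) 3) (sum_nonneg fun _ _ => norm_nonneg _)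
  -- the standard pattern is the Cooper pattern of `ω ∘ (1 2)` after the leg transposition `(1 2)` (pin kept by translation invariance)
  have hstd : ∀ (ω : Fin 4 → Fin 1) (x₁ : SpaceTimeIdx L M),
      fixedTupleL1 L M β 3 (sectorisedKernel L M β (trivialMultiplier L M) V 4) (fun i => ((ω i, ![(0 : Fin 2), 0, 1, 1] i), ![(0 : Fin 2), 1, 0, 1] i)) x₁ ≤
        imagTimeWeight β M ^ 3 * ((‖κ‖ * ((((2 * M : ℕ) : ℝ) * (L : ℝ) ^ 2) ^ 2)) * (Real.sqrt (10485760 * n₀) * (((2 * M : ℕ) : ℝ) * (L : ℝ) ^ 2))) *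
          ∑ i ∈ S, ‖a i‖ * A i + r := by
    intro ω x₁
    have hω : ω = fun _ => 0 := funext fun i => Fin.eq_zero (ω i)
    subst hω
    have hX : (fun i => ((((0 : Fin 1), (![0, 1, 0, 1] : Fin 4 → Fin 2) i) : Fin 1 × Fin 2), (![0, 0, 1, 1] : Fin 4 → Fin 2) i)) ∘ (Equiv.swap (1 : Fin 4) 2) =
        (fun i => ((((0 : Fin 1)), ![(0 : Fin 2), 0, 1, 1] i), ![(0 : Fin 2), 1, 0, 1] i) : Fin 4 → SectorLeg 1) := by
      funext i; fin_cases i <;> rfl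
    rw [← hX, fixedTupleL1_sectorisedKernel_comp_perm hβ.ne' (trivialMultiplier L M) V hfreq hmom]
    exact hT7 x₁
  exact fixedTupleL1_sectorisedKernel_klEffectiveAction_le_two_mul_of_std hβ (trivialMultiplier L M) U μ K e₀ n hS0 hstd
    (fun i => ((((0 : Fin 1), s i) : Fin 1 × Fin 2), c' i)) y

/-! ## §2 The quartic row of (X).1 at `(K, j)` from the representation -/

/-- **THE (X).1 QUARTIC ROW FROM ONE MOMENTUM-SPACE REPRESENTATION** (chain (T7) → patterns → (T3)): `∃ CA > 0` such that, under (T3)'s binders, a pair-transfer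
representation of the `↑↓` quartic momentum kernel of `𝒱_j[K] = klEffectiveAction … K klE0 j` with (T1) bump data, remainder line `r` and the closure
`2·klThinCountC·CA⁴·(2·(ε³·(‖κ‖(2M·L²)²)·√(10485760·n₀)·(2M·L²)·Σ‖a_i‖A_i + r)) ≤ c₂·(Klam·|U|)` gives `klAnisoLegKernelNormAt … K klE0 j 4 Ωe ≤ c₂·(Klam·|U|)·2^j` for
every prescription `Ωe`. [cite: BenfattoGiulianiMastropietro2006, §2.8 (2.76)-(2.81), (2.96)-(2.98), Lemma 2.5] -/
theorem levelsUQuarticRow_klEng_of_momentumRepresentation :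
    ∃ CA : ℝ, 0 < CA ∧ ∀ (P : SplitConsts) (R : RenConsts) (c : ℝ), P.WF → R.WF2 → 0 < c → c ≤ klEngC₃6 P R → c ≤ klThinCountC₃ R →
      ∀ μ ∈ klWindowC, ∀ U : ℝ, 0 < U → U ≤ klEngU₀9 P R c → U ≤ klThinCountU₀ R → ∀ β : ℝ, klBetaMin ≤ β → β ≤ Real.exp (c / U ^ 2) →
      ∀ K : TrigPolyC4v, FrameOK R U (nScales β) μ K → ∀ (L M : ℕ) [NeZero L] [NeZero M],
      klEngL₃ β U ≤ L → klEngM₃ β U L ≤ M → ∀ j : ℕ, 1 ≤ j → j ≤ nScales β + 1 →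
        ∀ {ι : Type} (S : Finset ι) (a : ι → ℂ) (κ : ℂ) (G : ι → TorusSite 1 (2 * M) × TorusSite 2 L → ℂ) (ρ : (Fin 4 → FreqMomentum L M) → ℂ),
        (∀ k : Fin 4 → FreqMomentum L M,
          kernel ℂ (klEffectiveAction L M β U μ K klE0 j) 4 (fun i => ((k i, (![0, 1, 0, 1] : Fin 4 → Fin 2) i), (![0, 0, 1, 1] : Fin 4 → Fin 2) i)) =
            ∑ i ∈ S, a i * (κ * (if ((fun _ : Fin 1 => ((((k 0).1 : ℕ) : ZMod (2 * M)))), (k 0).2) + ((fun _ : Fin 1 => ((((k 1).1 : ℕ) : ZMod (2 * M)))), (k 1).2) = (((fun _ : Fin 1 => ((((k 2).1 : ℕ) : ZMod (2 * M)))), (k 2).2) : TorusSite 1 (2 * M) × TorusSite 2 L) + ((fun _ : Fin 1 => ((((k 3).1 : ℕ) : ZMod (2 * M)))), (k 3).2) then (fun Q => G i (-Q)) (((fun _ : Fin 1 => ((((k 0).1 : ℕ) : ZMod (2 * M)))), (k 0).2) + ((fun _ : Fin 1 => ((((k 1).1 : ℕ) : ZMod (2 * M)))), (k 1).2)) else 0))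 + ρ k) →
        ∀ (s₀ s₁ A : ι → ℝ) (Ns : ι → ℕ) (n₀ r c₂ : ℝ), 0 ≤ n₀ →
        (∀ i ∈ S, 0 < s₀ i) → (∀ i ∈ S, s₀ i ≤ 1) → (∀ i ∈ S, 0 < s₁ i) → (∀ i ∈ S, s₁ i ≤ 1) → (∀ i ∈ S, 0 ≤ A i) →
        (∀ i ∈ S, (Ns i : ℝ) ≤ n₀ * (s₀ i * (2 * M : ℕ)) * (s₁ i * L) ^ 2) →
        (∀ i ∈ S, (univ.filter fun q => G i q ≠ 0).card ≤ Ns i) → (∀ i ∈ S, ∀ q, ‖G i q‖ ≤ A i) →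
        (∀ i ∈ S, ∀ q, ‖(fwdDiff ((fun _ : Fin 1 => (1 : ZMod (2 * M))), (0 : TorusSite 2 L)))^[2] (G i) q‖ ≤ A i * (4 / (s₀ i * (2 * M : ℕ))) ^ 2) →
        (∀ i ∈ S, ∀ q (l : Fin 2), ‖(fwdDiff ((0 : TorusSite 1 (2 * M)), (Pi.single l (1 : ZMod L) : TorusSite 2 L)))^[2] (G i) q‖ ≤ A i * (4 / (s₁ i * L)) ^ 2) →
        (∀ y : SpaceTimeIdx L M, fixedTupleL1 L M β 3
          (fun (Ω : Fin 4 → SectorLeg 1) (x : Fin 4 → SpaceTimeIdx L M) =>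
            ∑ k : Fin 4 → FreqMomentum L M, (∏ i, trivialMultiplier L M (Ω i).1.1 (k i) * hubbardPlaneWave L M β (Ω i).2 (k i) (x i)) * ρ k)
          (fun i : Fin 4 => ((((0 : Fin 1), (![0, 1, 0, 1] : Fin 4 → Fin 2) i) : Fin 1 × Fin 2), (![0, 0, 1, 1] : Fin 4 → Fin 2) i)) y ≤ r) →
        2 * klThinCountC * (CA ^ 4 * (2 * (imagTimeWeight β M ^ 3 * ((‖κ‖ * ((((2 * M : ℕ) : ℝ) * (L : ℝ) ^ 2) ^ 2)) *
          (Real.sqrt (10485760 * n₀) * (((2 * M : ℕ) : ℝ) * (L : ℝ) ^ 2))) * ∑ i ∈ S, ‖a i‖ * A i + r))) ≤ c₂ * (P.Klam * |U|) →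
          ∀ Ωe : Fin 4 → Option (SectorLeg (sectorCount j)),
            klAnisoLegKernelNormAt L M β U μ K klE0 j 4 Ωe ≤ c₂ * (P.Klam * |U|) * (2 : ℝ) ^ j := by
  obtain ⟨CA, hCA, h⟩ := levelsU_quarticRow_of_plainLine_klEng
  refine ⟨CA, hCA, ?_⟩
  intro P R c hP hR2 hc hc6 hcT μ hμ U hU hU9 hUT β hβmin hβc K hK L M _ _ hL3 hM3 j hj hjN ι S a κ G ρ hker s₀ s₁ A Ns n₀ r c₂ hn₀ hs₀ hs₀1 hs₁ hs₁1
    hA hNs hsupp hsup h₀ h₁ hr hrow Ωe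
  have hβ0 : 0 < β := KLRegimeSplit.pos_of_klBetaMin_le hβmin
  have hline := plainLine_klEffectiveAction_allStrings_of_momentumRepresentation hβ0 U μ K klE0 j S a κ G ρ hker s₀ s₁ A Ns hn₀ hs₀ hs₀1 hs₁ hs₁1
    hA hNs hsupp hsup h₀ h₁ hr
  have hS0 : 0 ≤ 2 * (imagTimeWeight β M ^ 3 * ((‖κ‖ * ((((2 * M : ℕ) : ℝ) * (L : ℝ) ^ 2) ^ 2)) *
      (Real.sqrt (10485760 * n₀) * (((2 * M : ℕ) : ℝ) * (L : ℝ) ^ 2))) * ∑ i ∈ S, ‖a i‖ * A i + r) := by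
    obtain ⟨y⟩ : Nonempty (SpaceTimeIdx L M) := inferInstance
    refine le_trans ?_ (hline 0 0 y)
    unfold fixedTupleL1
    exact mul_nonneg (pow_nonneg (imagTimeWeight_nonneg hβ0.le M) 3) (sum_nonneg fun _ _ => norm_nonneg _)
  exact h P R c hP hR2 hc hc6 hcT μ hμ U hU hU9 hUT β hβmin hβc K hK L M hL3 hM3 j hj hjN _ c₂ hS0 (fun s c' y₀ => hline s c' y₀) hrow Ωe

end Summit.HubbardSuperconductivity.HubbardSuperconductivity.Theorems.EngineV8

end
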